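import Summits.CriticalPhenomena.PercolationContinuityZ3.Theorems.PercNearOneGluingNoHeavyLowerTailDualBHKMaster
import Literature.Combinatorics.SetFamily.LocalizedFourFunctions
import HarnessLib

/-!
# Dual BHK inequality — the peeling step holds on every antipodal fibre of the peeled star

Support file for `stmt-CriticalPhenomena-4575` (memo `prim-gen-kcluster/KCLUSTER-gen62.md` §0.3 / §3,
"Theorem B"; the dual BHK development `…LowerTailDualBHK*.lean` of prim-ineq-gen-2).

The generic peeling step `DualBHK.ad_step` concludes `PrW E₁ · PrW E₂ ≤ PrW E₃ · PrW E₄` from the pointwise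
Ahlswede–Daykin hypothesis on the star of the peeled vertex `v`, by the four functions theorem.  Replacing the
four functions theorem by its *fibrewise* form (Reuter 1987 / Lovász–Saks 2006 / Chan–Pak 2023,
`Literature.Combinatorics.SetFamily.four_functions_fibre`) one obtains the same inequality **on every fibre
of the map `(T, T′) ↦ (T ∩ T′, T ∪ T′)` of star patterns**:

* `ad_step_fibre`: under the hypotheses of `ad_step`, for all `u, w`,
  `Σ_{(T,T′): T∩T′=u, T∪T′=w} PrW(E₁ ∩ [T]) · PrW(E₂ ∩ [T′]) ≤ Σ_{(T,T′)} PrW(E₃ ∩ [T]) · PrW(E₄ ∩ [T′])`,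
  where `[T] = {S : S ∩ star(v) = T}` is the set of configurations with open star pattern `T` at `v`.
* `master_starFibre`: the family `MASTER(M,M′,𝔐;X,Y,N)` of `DualBHK.master_univ`, peeled at any
  `v ∈ X ∩ Y ∖ (𝔐 ∪ {a})`, holds fibrewise at `v` in this sense (the AD hypotheses are instances of `master_univ`).
* `dualBHK_starFibre`: in particular the dual BHK row `t · n′_a ≤ u_b · u_c` (`DualBHK.dualBHK`, the case
  `M = M′ = 𝔐 = {b}`, `X = Y = N = {c}`) holds after conditioning the two independent copies on any antipodal
  fibre of their open star patterns at `c`: for two independent percolations `ω, ω′` and every `u ⊆ w ⊆ star(c)`,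
  `P[(ω,ω′) : (ω ∩ ω′)|_{star c} = u, (ω ∪ ω′)|_{star c} = w, ω ∈ T, ω′ ∈ N′] ≤ P[same fibre, ω ∈ U_c-type, ω′ ∈ U_b-type]`
  — e.g. for the pair law that is perfectly *antithetic* on the star of `c` and independent elsewhere.  Summing over
  all fibres returns `dualBHK`; the fully fibrewise statement (all coordinates) is conjecture ANTI₁ of
  `KCLUSTER-gen52` §3.  [this work]
-/

namespace Summit.CriticalPhenomena.PercolationContinuityZ3.Theorems

namespace DualBHK

open Finset Literature.Probability.Percolation.DecisionTree Literature.Combinatorics.SetFamily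

section StarFibre

variable {V : Type*} [DecidableEq V] [Fintype V]
variable {D F E : Finset (Sym2 V)} {p : Sym2 V → ℝ} {a : V}

omit [Fintype V] in
/-- **Pattern decomposition of a mass.**  With `A` the star of `v` inside `D` and `B = D ∖ A`: for `T ⊆ A`, the mass of
`Ev` restricted to the configurations with open star pattern `T` is `wtW_A(T) · PrW_B(G(K(T)))`, for an event `Ev` that
translates into `G` (`htr`) with `G` ignoring the star (`hloc`). [this work] -/
theorem PrW_inter_pattern (U : Finset V) (v : V) (Ev : Set (Finset (Sym2 V))) (G : Set V → Set (Finset (Sym2 V)))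
    (htr : ∀ S, S ⊆ D → (S ∈ Ev ↔ S ∈ G (Kset U (S ∪ F) v)))
    (hloc : ∀ K (T R : Finset (Sym2 V)), (∀ e ∈ T, v ∈ e) → (T ∪ R ∈ G K ↔ R ∈ G K))
    {T : Finset (Sym2 V)} (hT : T ⊆ D.filter (fun e => v ∈ e)) :
    PrW D p (Ev ∩ {S | S ∩ D.filter (fun e => v ∈ e) = T}) =
      wtW (D.filter (fun e => v ∈ e)) p T * PrW (D.filter (fun e => v ∉ e)) p (G (Kset U (T ∪ F) v)) := by
  set A : Finset (Sym2 V) := D.filter (fun e => v ∈ e) with hA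
  set B : Finset (Sym2 V) := D.filter (fun e => v ∉ e) with hB
  have hAB : Disjoint A B := Finset.disjoint_filter_filter_not D D (fun e => v ∈ e)
  have hDAB : D = A ∪ B := (Finset.filter_union_filter_not_eq (fun e => v ∈ e) D).symm
  have hAv : ∀ e ∈ T, v ∈ e := fun e he => (Finset.mem_filter.1 (hT he)).2
  have hBv : ∀ R, R ⊆ B → ∀ e ∈ R, v ∉ e := fun R hR e he => (Finset.mem_filter.1 (hR he)).2
  -- the pattern of `T'' ∪ R` is `T''`
  have hpat : ∀ T'', T'' ⊆ A → ∀ R, R ⊆ B → (T'' ∪ R) ∩ A = T'' := by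
    intro T'' hT'' R hR
    ext e
    simp only [Finset.mem_inter, Finset.mem_union]
    constructor
    · rintro ⟨he | he, heA⟩
      · exact he
      · exact absurd heA (Finset.disjoint_right.1 hAB (hR he))
    · exact fun he => ⟨Or.inl he, hT'' he⟩
  rw [hDAB, PrW_union_eq_sum hAB p (Ev ∩ {S | S ∩ A = T})]
  rw [Finset.sum_eq_single_of_mem T (Finset.mem_powerset.2 hT)]
  · rw [PrW_eq_sum_ind]
    congr 1
    refine Finset.sum_congr rfl fun R hR => ?_
    have hR' := Finset.mem_powerset.1 hR
    congr 1
    have hTRD : T ∪ R ⊆ D := by rw [hDAB]; exact Finset.union_subset_union hT hR'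
    have hK : Kset U (T ∪ R ∪ F) v = Kset U (T ∪ F) v := Kset_union_of_avoid (hBv R hR')
    have h := htr (T ∪ R) hTRD
    rw [hK, hloc _ T R hAv] at h
    have hmem : T ∪ R ∈ Ev ∩ {S | S ∩ A = T} ↔ R ∈ G (Kset U (T ∪ F) v) := by
      rw [Set.mem_inter_iff, Set.mem_setOf_eq, hpat T hT R hR']
      exact ⟨fun hm => h.1 hm.1, fun hm => ⟨h.2 hm, rfl⟩⟩
    by_cases hm : R ∈ G (Kset U (T ∪ F) v)
    · rw [ind_of_mem hm, ind_of_mem (hmem.2 hm)]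
    · rw [ind_of_not_mem hm, ind_of_not_mem (fun h' => hm (hmem.1 h'))]
  · intro T'' hT'' hne
    have hT''A := Finset.mem_powerset.1 hT''
    refine mul_eq_zero_of_right _ (Finset.sum_eq_zero fun R hR => ?_)
    have hR' := Finset.mem_powerset.1 hR
    have : T'' ∪ R ∉ Ev ∩ {S | S ∩ A = T} := by
      rintro ⟨_, hS⟩
      rw [Set.mem_setOf_eq, hpat T'' hT''A R hR'] at hS
      exact hne hS
    rw [ind_of_not_mem this, mul_zero]

omit [Fintype V] in
/-- A pattern not inside the star has empty cylinder. [this work] -/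
theorem PrW_inter_pattern_eq_zero (v : V) (Ev : Set (Finset (Sym2 V))) {T : Finset (Sym2 V)}
    (hT : ¬ T ⊆ D.filter (fun e => v ∈ e)) :
    PrW D p (Ev ∩ {S | S ∩ D.filter (fun e => v ∈ e) = T}) = 0 := by
  refine PrW_eq_zero_of_forall_not_mem D p fun S => ?_
  rintro ⟨_, hS⟩
  rw [Set.mem_setOf_eq] at hS
  exact hT (hS ▸ Finset.inter_subset_right)

/-- **The peeling step on a fibre of the star** (fibrewise form of `DualBHK.ad_step`).  Under the hypotheses of
`ad_step` at `v`, for all `u, w`: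
`Σ_{(T,T′) : T ∩ T′ = u, T ∪ T′ = w} PrW(E₁ ∩ [T]) PrW(E₂ ∩ [T′]) ≤ Σ_{(T,T′)} PrW(E₃ ∩ [T]) PrW(E₄ ∩ [T′])`, `[T]` the set of
configurations with open star pattern `T` at `v`.  Proof: the four functions `T ↦ PrW(Eᵢ ∩ [T])` satisfy the
Ahlswede–Daykin hypothesis on the lattice of finite edge sets (pattern decomposition + `hAD` + the weight identity
`w(T∩T′)w(T∪T′) = w(T)w(T′)`), and the fibrewise four functions theorem
`Literature.Combinatorics.SetFamily.four_functions_fibre` [cite: ChanPak2023, Claim 6.3] applies. [this work] -/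
theorem ad_step_fibre (hp0 : ∀ e, 0 ≤ p e) (hp1 : ∀ e, p e ≤ 1)
    (hDE : D ⊆ E) (hFE : F ⊆ E) (U : Finset V) (v : V)
    (E₁ E₂ E₃ E₄ : Set (Finset (Sym2 V))) (G₁ G₂ G₃ G₄ : Set V → Set (Finset (Sym2 V)))
    (htr₁ : ∀ S, S ⊆ D → (S ∈ E₁ ↔ S ∈ G₁ (Kset U (S ∪ F) v)))
    (htr₂ : ∀ S, S ⊆ D → (S ∈ E₂ ↔ S ∈ G₂ (Kset U (S ∪ F) v)))
    (htr₃ : ∀ S, S ⊆ D → (S ∈ E₃ ↔ S ∈ G₃ (Kset U (S ∪ F) v)))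
    (htr₄ : ∀ S, S ⊆ D → (S ∈ E₄ ↔ S ∈ G₄ (Kset U (S ∪ F) v)))
    (hloc₁ : ∀ K (T R : Finset (Sym2 V)), (∀ e ∈ T, v ∈ e) → (T ∪ R ∈ G₁ K ↔ R ∈ G₁ K))
    (hloc₂ : ∀ K (T R : Finset (Sym2 V)), (∀ e ∈ T, v ∈ e) → (T ∪ R ∈ G₂ K ↔ R ∈ G₂ K))
    (hloc₃ : ∀ K (T R : Finset (Sym2 V)), (∀ e ∈ T, v ∈ e) → (T ∪ R ∈ G₃ K ↔ R ∈ G₃ K))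
    (hloc₄ : ∀ K (T R : Finset (Sym2 V)), (∀ e ∈ T, v ∈ e) → (T ∪ R ∈ G₄ K ↔ R ∈ G₄ K))
    (hAD : ∀ K K' : Set V, K ⊆ Kset U E v → K' ⊆ Kset U E v →
      PrW D p (G₁ K) * PrW D p (G₂ K') ≤ PrW D p (G₃ (K ∩ K')) * PrW D p (G₄ (K ∪ K')))
    (u w : Finset (Sym2 V)) :
    ∑ q ∈ meetJoinFibre u w,
        PrW D p (E₁ ∩ {S | S ∩ D.filter (fun e => v ∈ e) = q.1}) *
          PrW D p (E₂ ∩ {S | S ∩ D.filter (fun e => v ∈ e) = q.2}) ≤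
      ∑ q ∈ meetJoinFibre u w,
        PrW D p (E₃ ∩ {S | S ∩ D.filter (fun e => v ∈ e) = q.1}) *
          PrW D p (E₄ ∩ {S | S ∩ D.filter (fun e => v ∈ e) = q.2}) := by
  set A : Finset (Sym2 V) := D.filter (fun e => v ∈ e) with hA
  set B : Finset (Sym2 V) := D.filter (fun e => v ∉ e) with hB
  have hAB : Disjoint A B := Finset.disjoint_filter_filter_not D D (fun e => v ∈ e)
  have hDAB : D = A ∪ B := (Finset.filter_union_filter_not_eq (fun e => v ∈ e) D).symm
  have hnn : ∀ X : Set (Finset (Sym2 V)), 0 ≤ PrW D p X := fun X => PrW_nonneg D hp0 hp1 X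
  -- locality of the translated events: their `D`-mass is their `B`-mass
  have hlocal : ∀ (G : Set V → Set (Finset (Sym2 V))),
      (∀ K (T R : Finset (Sym2 V)), (∀ e ∈ T, v ∈ e) → (T ∪ R ∈ G K ↔ R ∈ G K)) →
      ∀ K, PrW D p (G K) = PrW B p (G K) := by
    intro G hG K
    rw [hDAB]
    exact PrW_local hAB p fun T hT R _ => hG K T R (fun e he => (Finset.mem_filter.1 (hT he)).2)
  -- the four functions
  set f₁ : Finset (Sym2 V) → ℝ := fun T => PrW D p (E₁ ∩ {S | S ∩ A = T}) with hf₁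
  set f₂ : Finset (Sym2 V) → ℝ := fun T => PrW D p (E₂ ∩ {S | S ∩ A = T}) with hf₂
  set f₃ : Finset (Sym2 V) → ℝ := fun T => PrW D p (E₃ ∩ {S | S ∩ A = T}) with hf₃
  set f₄ : Finset (Sym2 V) → ℝ := fun T => PrW D p (E₄ ∩ {S | S ∩ A = T}) with hf₄
  have key := four_functions_fibre f₁ f₂ f₄ f₃ (fun T => hnn _) (fun T => hnn _) (fun T => hnn _)
    (fun T => hnn _) ?_ u w
  · calc ∑ q ∈ meetJoinFibre u w, f₁ q.1 * f₂ q.2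
        ≤ ∑ q ∈ meetJoinFibre u w, f₄ q.1 * f₃ q.2 := key
      _ = ∑ q ∈ meetJoinFibre u w, f₃ q.1 * f₄ q.2 := by
          rw [sum_meetJoinFibre_swap (fun x y => f₄ x * f₃ y) u w]
          exact Finset.sum_congr rfl fun q _ => mul_comm _ _
  -- the Ahlswede–Daykin hypothesis `f₁ T · f₂ T′ ≤ f₄ (T ∪ T′) · f₃ (T ∩ T′)`
  intro T T'
  show f₁ T * f₂ T' ≤ f₄ (T ∪ T') * f₃ (T ∩ T')
  by_cases hT : T ⊆ A
  swap
  · rw [hf₁]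
    simp only
    rw [PrW_inter_pattern_eq_zero v E₁ hT, zero_mul]
    exact mul_nonneg (hnn _) (hnn _)
  by_cases hT' : T' ⊆ A
  swap
  · rw [hf₂]
    simp only
    rw [PrW_inter_pattern_eq_zero v E₂ hT', mul_zero]
    exact mul_nonneg (hnn _) (hnn _)
  have hTT'u : T ∪ T' ⊆ A := Finset.union_subset hT hT'
  have hTT'i : T ∩ T' ⊆ A := Finset.inter_subset_left.trans hT
  simp only [hf₁, hf₂, hf₃, hf₄]
  rw [PrW_inter_pattern U v E₁ G₁ htr₁ hloc₁ hT, PrW_inter_pattern U v E₂ G₂ htr₂ hloc₂ hT',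
    PrW_inter_pattern U v E₃ G₃ htr₃ hloc₃ hTT'i, PrW_inter_pattern U v E₄ G₄ htr₄ hloc₄ hTT'u]
  have hAD' : ∀ T, T ⊆ A → T ⊆ D := fun T hT => hT.trans (Finset.filter_subset _ _)
  have hKT : Kset U (T ∪ F) v ⊆ Kset U E v :=
    Kset_mono (Finset.union_subset ((hAD' T hT).trans hDE) hFE)
  have hKT' : Kset U (T' ∪ F) v ⊆ Kset U E v :=
    Kset_mono (Finset.union_subset ((hAD' T' hT').trans hDE) hFE)
  have h := hAD _ _ hKT hKT'
  rw [hlocal G₁ hloc₁, hlocal G₂ hloc₂, hlocal G₃ hloc₃, hlocal G₄ hloc₄] at h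
  have hw := wtW_inter_mul_union A p T T'
  rw [Kset_inter_union, Kset_union_union]
  calc wtW A p T * PrW B p (G₁ (Kset U (T ∪ F) v)) * (wtW A p T' * PrW B p (G₂ (Kset U (T' ∪ F) v)))
      = (wtW A p T * wtW A p T') *
          (PrW B p (G₁ (Kset U (T ∪ F) v)) * PrW B p (G₂ (Kset U (T' ∪ F) v))) := by ring
    _ ≤ (wtW A p (T ∩ T') * wtW A p (T ∪ T')) *
          (PrW B p (G₃ (Kset U (T ∪ F) v ∩ Kset U (T' ∪ F) v)) *
            PrW B p (G₄ (Kset U (T ∪ F) v ∪ Kset U (T' ∪ F) v))) := by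
        rw [hw]
        exact mul_le_mul_of_nonneg_left h (mul_nonneg (wtW_nonneg A hp0 hp1 T) (wtW_nonneg A hp0 hp1 T'))
    _ = wtW A p (T ∪ T') * PrW B p (G₄ (Kset U (T ∪ F) v ∪ Kset U (T' ∪ F) v)) *
          (wtW A p (T ∩ T') * PrW B p (G₃ (Kset U (T ∪ F) v ∩ Kset U (T' ∪ F) v))) := by ring

/-- **The family `MASTER` holds on every fibre of the star of a peeled vertex** (fibrewise form of the peeling step
`peel_c` of `DualBHK.master_univ`).  For `M, M′ ⊆ 𝔐 ⊆ U`, `X, Y ⊆ N ⊆ U`, `a ∈ U` and `v ∈ X ∩ Y`, `v ∉ 𝔐 ∪ {a}`: with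
`E₁ = t(M,X)`, `E₂ = q⁺(M′∪Y;𝔐,N)`, `E₃ = Ξ(M∪M′;X∩Y)`, `E₄ = Ξ(X∪Y;M∩M′)` and `[T]` the configurations with open star
pattern `T` at `v`, for all `u, w`:
`Σ_{T∩T′=u, T∪T′=w} PrW(E₁ ∩ [T]) PrW(E₂ ∩ [T′]) ≤ Σ PrW(E₃ ∩ [T]) PrW(E₄ ∩ [T′])`.
The AD hypotheses are instances of `master_univ` on `U ∖ v`, exactly as in its proof. [this work] -/
theorem master_starFibre (hp0 : ∀ e, 0 ≤ p e) (hp1 : ∀ e, p e ≤ 1) (hDE : D ⊆ E) (hFE : F ⊆ E) (U : Finset V)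
    (M M' MM X Y N : Set V) (haU : a ∈ U) (hMMU : MM ⊆ ↑U) (hNU : N ⊆ ↑U) (hM : M ⊆ MM) (hM' : M' ⊆ MM)
    (hXN : X ⊆ N) (hYN : Y ⊆ N) (v : V) (hvX : v ∈ X) (hvY : v ∈ Y) (hvMM : v ∉ MM) (hva : v ≠ a)
    (u w : Finset (Sym2 V)) :
    ∑ q ∈ meetJoinFibre u w,
        PrW D p (evT U F a M X ∩ {S | S ∩ D.filter (fun e => v ∈ e) = q.1}) *
          PrW D p (evQp U E F a (M' ∪ Y) MM N ∩ {S | S ∩ D.filter (fun e => v ∈ e) = q.2}) ≤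
      ∑ q ∈ meetJoinFibre u w,
        PrW D p (evXi U F a (M ∪ M') (X ∩ Y) ∩ {S | S ∩ D.filter (fun e => v ∈ e) = q.1}) *
          PrW D p (evXi U F a (X ∪ Y) (M ∩ M') ∩ {S | S ∩ D.filter (fun e => v ∈ e) = q.2}) := by
  have hnn : ∀ X : Set (Finset (Sym2 V)), 0 ≤ PrW D p X := fun X => PrW_nonneg D hp0 hp1 X
  have hav : a ≠ v := fun h => hva h.symm
  have hvM : v ∉ M := fun h => hvMM (hM h)
  have hvM' : v ∉ M' := fun h => hvMM (hM' h)
  have hvN : v ∈ N := hYN hvY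
  have hvU : v ∈ U := hNU hvN
  have haU' : a ∈ U.erase v := Finset.mem_erase.2 ⟨hav, haU⟩
  have hMMU' : MM ⊆ ↑(U.erase v) := fun m hm => by
    rw [Finset.coe_erase]
    exact ⟨hMMU hm, fun h => hvMM (by rw [Set.mem_singleton_iff.1 h] at hm; exact hm)⟩
  have hN1 : (N \ {v}) ∪ Kset U E v ⊆ ↑(U.erase v) := by
    rintro d (⟨hdN, hdv⟩ | hdK)
    · rw [Finset.coe_erase]; exact ⟨hNU hdN, hdv⟩
    · rw [Finset.coe_erase]; exact ⟨hdK.1, fun h => hdK.2.1 (Set.mem_singleton_iff.1 h)⟩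
  have hvMY : v ∈ M' ∪ Y := Or.inr hvY
  have hvA : v ∉ M ∪ M' := by
    rintro (h | h)
    · exact hvM h
    · exact hvM' h
  have hvB : v ∉ M ∩ M' := fun h => hvM h.1
  refine ad_step_fibre hp0 hp1 hDE hFE U v _ _ _ _
    (fun K => evT (U.erase v) F a M ((X \ {v}) ∪ K))
    (fun K => evQp (U.erase v) E F a (((M' ∪ Y) \ {v}) ∪ K) MM ((N \ {v}) ∪ Kset U E v))
    (fun K => evXi (U.erase v) F a (M ∪ M') (((X ∩ Y) \ {v}) ∪ K))
    (fun K => evXi (U.erase v) F a (((X ∪ Y) \ {v}) ∪ K) (M ∩ M'))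
    (fun S _ => mem_evT_peel_iff hvU hav hvX hvM)
    (fun S _ => mem_evQp_peel_iff hvU hav hvMY hvMM hvN)
    (fun S _ => mem_evXi_peel_avoid_iff hvU hav ⟨hvX, hvY⟩ hvA)
    (fun S _ => mem_evXi_peel_hub_iff hvU hav (Or.inl hvX) hvB)
    (fun K T R hT => union_mem_evT_erase_iff hT R M _)
    (fun K T R hT => union_mem_evQp_erase_iff hT R _ MM _)
    (fun K T R hT => union_mem_evXi_erase_iff hT R _ _)
    (fun K T R hT => union_mem_evXi_erase_iff hT R _ _)
    ?_ u w
  intro K K' hK hK'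
  have hX1 : (X \ {v}) ∪ K ⊆ (N \ {v}) ∪ Kset U E v :=
    Set.union_subset_union (Set.sdiff_subset_sdiff_left hXN) hK
  have hY1 : (Y \ {v}) ∪ K' ⊆ (N \ {v}) ∪ Kset U E v :=
    Set.union_subset_union (Set.sdiff_subset_sdiff_left hYN) hK'
  have IH := master_univ hp0 hp1 hDE hFE (U.erase v) M M' MM ((X \ {v}) ∪ K) ((Y \ {v}) ∪ K')
    ((N \ {v}) ∪ Kset U E v) haU' hMMU' hN1 hM hM' hX1 hY1
  -- factor 2: `((M′ ∪ Y) ∖ v) ∪ K′ = M′ ∪ Y^{K′}` as `v ∉ M′`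
  have h2 : evQp (U.erase v) E F a (((M' ∪ Y) \ {v}) ∪ K') MM ((N \ {v}) ∪ Kset U E v) =
      evQp (U.erase v) E F a (M' ∪ ((Y \ {v}) ∪ K')) MM ((N \ {v}) ∪ Kset U E v) := by
    congr 1
    ext d
    simp only [Set.mem_union, Set.mem_sdiff, Set.mem_singleton_iff]
    constructor
    · rintro (⟨hd | hd, hdv⟩ | hd)
      · exact Or.inl hd
      · exact Or.inr (Or.inl ⟨hd, hdv⟩)
      · exact Or.inr (Or.inr hd)
    · rintro (hd | ⟨hd, hdv⟩ | hd)
      · exact Or.inl ⟨Or.inl hd, fun h => hvM' (h ▸ hd)⟩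
      · exact Or.inl ⟨Or.inr hd, hdv⟩
      · exact Or.inr hd
  -- factor 3: antitone in the avoided set
  have h3 : PrW D p (evXi (U.erase v) F a (M ∪ M') (((X \ {v}) ∪ K) ∩ ((Y \ {v}) ∪ K'))) ≤
      PrW D p (evXi (U.erase v) F a (M ∪ M') (((X ∩ Y) \ {v}) ∪ (K ∩ K'))) := by
    refine PrW_mono D hp0 hp1 fun S _ hS => evXi_anti ?_ hS
    rintro d (⟨⟨hdX, hdY⟩, hdv⟩ | ⟨hdK, hdK'⟩)
    · exact ⟨Or.inl ⟨hdX, hdv⟩, Or.inl ⟨hdY, hdv⟩⟩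
    · exact ⟨Or.inr hdK, Or.inr hdK'⟩
  -- factor 4: equal hubs
  have h4 : evXi (U.erase v) F a (((X \ {v}) ∪ K) ∪ ((Y \ {v}) ∪ K')) (M ∩ M') =
      evXi (U.erase v) F a (((X ∪ Y) \ {v}) ∪ (K ∪ K')) (M ∩ M') := by
    congr 1
    ext d
    simp only [Set.mem_union, Set.mem_sdiff, Set.mem_singleton_iff]
    tauto
  show PrW D p (evT (U.erase v) F a M ((X \ {v}) ∪ K)) *
      PrW D p (evQp (U.erase v) E F a (((M' ∪ Y) \ {v}) ∪ K') MM ((N \ {v}) ∪ Kset U E v)) ≤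
    PrW D p (evXi (U.erase v) F a (M ∪ M') (((X ∩ Y) \ {v}) ∪ (K ∩ K'))) *
      PrW D p (evXi (U.erase v) F a (((X ∪ Y) \ {v}) ∪ (K ∪ K')) (M ∩ M'))
  rw [h2, ← h4]
  exact IH.trans (mul_le_mul_of_nonneg_right h3 (hnn _))

/-- **The dual BHK row is fibrewise at the star of `c`** (memo `KCLUSTER-gen62` §0.3, one-star form of Theorem B).
For a finite weighted graph (`D ⊆ E`, forced edges `F ⊆ E`, weights `p ∈ [0,1]`), a universe `U ∋ a`, terminals
`b, c ∈ U` with `c ≠ a`, `c ≠ b`, and every `u, w` (antipodal fibre `{(T,T′) : T ∩ T′ = u, T ∪ T′ = w}` of open star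
patterns at `c`; `[T]` = configurations whose open star pattern at `c` inside `D` is `T`):
`Σ_{(T,T′)} PrW(t({b},{c}) ∩ [T]) · PrW(q⁺({b}∪{c};{b},{c}) ∩ [T′]) ≤ Σ_{(T,T′)} PrW(Ξ({b};{c}) ∩ [T]) · PrW(Ξ({c};{b}) ∩ [T′])`
— i.e. `t · n′_a ≤ u_c · u_b` holds for two copies that are independent off the star of `c` and conditioned on an
arbitrary antipodal star fibre at `c` (for instance perfectly antithetic on the star of `c`).  Summed over all fibres
this is `DualBHK.dualBHK`.  Proof: `master_starFibre` with `M = M′ = 𝔐 = {b}`, `X = Y = N = {c}`, `v = c`, plus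
`four_functions_fibre` [cite: ChanPak2023, Claim 6.3]. [this work] -/
theorem dualBHK_starFibre (hp0 : ∀ e, 0 ≤ p e) (hp1 : ∀ e, p e ≤ 1) (hDE : D ⊆ E) (hFE : F ⊆ E) (U : Finset V)
    {b c : V} (haU : a ∈ U) (hbU : b ∈ U) (hcU : c ∈ U) (hca : c ≠ a) (hcb : c ≠ b)
    (u w : Finset (Sym2 V)) :
    ∑ q ∈ meetJoinFibre u w,
        PrW D p (evT U F a {b} {c} ∩ {S | S ∩ D.filter (fun e => c ∈ e) = q.1}) *
          PrW D p (evQp U E F a ({b} ∪ {c}) {b} {c} ∩ {S | S ∩ D.filter (fun e => c ∈ e) = q.2}) ≤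
      ∑ q ∈ meetJoinFibre u w,
        PrW D p (evXi U F a {b} {c} ∩ {S | S ∩ D.filter (fun e => c ∈ e) = q.1}) *
          PrW D p (evXi U F a {c} {b} ∩ {S | S ∩ D.filter (fun e => c ∈ e) = q.2}) := by
  have h := master_starFibre hp0 hp1 hDE hFE U {b} {b} {b} {c} {c} {c} haU
    (by simpa using hbU) (by simpa using hcU) subset_rfl subset_rfl subset_rfl subset_rfl c rfl rfl
    (by simpa using hcb) hca u w
  simpa only [Set.union_self, Set.inter_self] using h

/-- **`MASTER` on every fibre of the star of a peeled HUB vertex** `v ∈ M ∩ M′ ∖ (N ∪ {a})` (the mirror case of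
`master_starFibre`, by the exchange symmetry `(M,M′,𝔐) ↔ (X,Y,N)` of the family, `evT_comm`, `evQp_swap`, and the
symmetry of the fibre under swapping the pair). [this work] -/
theorem master_starFibre_hub (hp0 : ∀ e, 0 ≤ p e) (hp1 : ∀ e, p e ≤ 1) (hDE : D ⊆ E) (hFE : F ⊆ E) (U : Finset V)
    (M M' MM X Y N : Set V) (haU : a ∈ U) (hMMU : MM ⊆ ↑U) (hNU : N ⊆ ↑U) (hM : M ⊆ MM) (hM' : M' ⊆ MM)
    (hXN : X ⊆ N) (hYN : Y ⊆ N) (v : V) (hvM : v ∈ M) (hvM' : v ∈ M') (hvN : v ∉ N) (hva : v ≠ a)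
    (u w : Finset (Sym2 V)) :
    ∑ q ∈ meetJoinFibre u w,
        PrW D p (evT U F a M X ∩ {S | S ∩ D.filter (fun e => v ∈ e) = q.1}) *
          PrW D p (evQp U E F a (M' ∪ Y) MM N ∩ {S | S ∩ D.filter (fun e => v ∈ e) = q.2}) ≤
      ∑ q ∈ meetJoinFibre u w,
        PrW D p (evXi U F a (M ∪ M') (X ∩ Y) ∩ {S | S ∩ D.filter (fun e => v ∈ e) = q.1}) *
          PrW D p (evXi U F a (X ∪ Y) (M ∩ M') ∩ {S | S ∩ D.filter (fun e => v ∈ e) = q.2}) := by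
  have h := master_starFibre hp0 hp1 hDE hFE U X Y N M M' MM haU hNU hMMU hXN hYN hM hM' v hvM hvM' hvN hva u w
  rw [← evT_comm M X, ← evQp_swap U M' Y MM N] at h
  refine h.trans_eq ?_
  rw [sum_meetJoinFibre_swap (fun x y =>
    PrW D p (evXi U F a (X ∪ Y) (M ∩ M') ∩ {S | S ∩ D.filter (fun e => v ∈ e) = x}) *
      PrW D p (evXi U F a (M ∪ M') (X ∩ Y) ∩ {S | S ∩ D.filter (fun e => v ∈ e) = y})) u w]
  exact Finset.sum_congr rfl fun q _ => mul_comm _ _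

/-- **The dual BHK row is fibrewise at the star of `b`** (companion of `dualBHK_starFibre`; here no hypothesis
`b ≁ c` is needed, only `b ≠ a`, `b ≠ c`): for every antipodal fibre `{(T,T′) : T ∩ T′ = u, T ∪ T′ = w}` of open star
patterns at `b`,
`Σ PrW(t({b},{c}) ∩ [T]) · PrW(q⁺({b}∪{c};{b},{c}) ∩ [T′]) ≤ Σ PrW(Ξ({b};{c}) ∩ [T]) · PrW(Ξ({c};{b}) ∩ [T′])`.
Proof: `master_starFibre_hub` with `M = M′ = 𝔐 = {b}`, `X = Y = N = {c}`, `v = b`, i.e. the peeling of the hub `b` and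
Reuter's fibrewise four functions theorem [cite: ChanPak2023, Claim 6.3]. [this work] -/
theorem dualBHK_starFibre_hub (hp0 : ∀ e, 0 ≤ p e) (hp1 : ∀ e, p e ≤ 1) (hDE : D ⊆ E) (hFE : F ⊆ E) (U : Finset V)
    {b c : V} (haU : a ∈ U) (hbU : b ∈ U) (hcU : c ∈ U) (hba : b ≠ a) (hbc : b ≠ c)
    (u w : Finset (Sym2 V)) :
    ∑ q ∈ meetJoinFibre u w,
        PrW D p (evT U F a {b} {c} ∩ {S | S ∩ D.filter (fun e => b ∈ e) = q.1}) *
          PrW D p (evQp U E F a ({b} ∪ {c}) {b} {c} ∩ {S | S ∩ D.filter (fun e => b ∈ e) = q.2}) ≤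
      ∑ q ∈ meetJoinFibre u w,
        PrW D p (evXi U F a {b} {c} ∩ {S | S ∩ D.filter (fun e => b ∈ e) = q.1}) *
          PrW D p (evXi U F a {c} {b} ∩ {S | S ∩ D.filter (fun e => b ∈ e) = q.2}) := by
  have h := master_starFibre_hub hp0 hp1 hDE hFE U {b} {b} {b} {c} {c} {c} haU
    (by simpa using hbU) (by simpa using hcU) subset_rfl subset_rfl subset_rfl subset_rfl b rfl rfl
    (by simpa using hbc) hba u w
  simpa only [Set.union_self, Set.inter_self] using h

end StarFibre

end DualBHK

end Summit.CriticalPhenomena.PercolationContinuityZ3.Theorems
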